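import Summits.Ventures.PercRepro.S1CFGTrianglesAllTools

/-!
# PercRepro — THE SERIES CLASS OF A POINT (p1, gen 40)

`M` finite, coloop-free; for `e ∈ E` the SERIES CLASS `Z(e) := {z ∈ E | z = e ∨ z ∉ cl (E ∖ {e, z})}` — `e` and the
coloops of `M ∖ e` (the points `z` with `{e, z}` a cocircuit). Written out in every statement (no definition):
`{z | z ∈ M.E ∧ (z = e ∨ z ∉ M.closure (M.E \ {e, z}))}`.
* `isCircuit_seriesClass_subset` — a circuit meeting `Z(e)` contains `Z(e)` (series pairs are symmetric:
  `notMem_closure_sdiff_pair_symm`);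
* `mem_closure_sdiff_seriesClass` — every point `g ∉ Z(e)` lies in `cl ((E ∖ Z(e)) ∖ {g})`: the restriction to
  `E ∖ Z(e)` is COLOOP-FREE (a circuit through `g` avoiding `e` avoids `Z(e)`);
* `eRk_toNat_sdiff_seriesClass_add` — `rk (E ∖ Z(e)) + |Z(e)| = rk E + 1` (the points of `Z(e) ∖ {e}` are coloops of
  `M ∖ e`: one rank each);
* `ncard_sdiff_seriesClass_eq` — `E ∖ Z(e)` has nullity `ν − 1` (the natural-number form of the restriction package).
Nothing about any cell is claimed. Axioms: standard.
-/

open scoped Matroid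

namespace PercRepro

namespace S1CFG

open Set S1CF

variable {α : Type}

/-- The series class of `e` contains `e`. -/
theorem mem_seriesClass_self (M : Matroid α) {e : α} (he : e ∈ M.E) :
    e ∈ {z | z ∈ M.E ∧ (z = e ∨ z ∉ M.closure (M.E \ {e, z}))} := ⟨he, Or.inl rfl⟩

/-- The series class of `e` lies in `E`. -/
theorem seriesClass_subset_ground (M : Matroid α) (e : α) :
    {z | z ∈ M.E ∧ (z = e ∨ z ∉ M.closure (M.E \ {e, z}))} ⊆ M.E := fun _ hz => hz.1

/-- A circuit through `e` contains every point of the series class of `e`. -/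
theorem isCircuit_seriesClass_subset_of_mem (M : Matroid α) [M.Finite] (hK : ∀ e, ¬ M.IsColoop e) {e : α}
    (he : e ∈ M.E) {C : Set α} (hC : M.IsCircuit C) (heC : e ∈ C) :
    {z | z ∈ M.E ∧ (z = e ∨ z ∉ M.closure (M.E \ {e, z}))} ⊆ C := by
  intro z hz
  obtain ⟨hzE, hz⟩ := hz
  rcases hz with rfl | hzcl
  · exact heC
  by_contra hzC
  have hze : z ≠ e := fun h => hzC (h ▸ heC)
  have he' := notMem_closure_sdiff_pair_symm M hK he hzE hze.symm hzcl
  have hsub : C \ {e} ⊆ M.E \ {e, z} := by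
    intro x hx
    refine ⟨hC.subset_ground hx.1, ?_⟩
    simp only [mem_insert_iff, mem_singleton_iff, not_or]
    exact ⟨hx.2, fun hxz => hzC (hxz ▸ hx.1)⟩
  exact he' (M.closure_subset_closure hsub (hC.mem_closure_sdiff_singleton_of_mem heC))

/-- **A CIRCUIT MEETING THE SERIES CLASS CONTAINS IT**: if a circuit `C` contains some `z ∈ Z(e)` then `Z(e) ⊆ C`. -/
theorem isCircuit_seriesClass_subset (M : Matroid α) [M.Finite] (hK : ∀ e, ¬ M.IsColoop e) {e : α}
    (he : e ∈ M.E) {C : Set α} (hC : M.IsCircuit C) {z : α}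
    (hz : z ∈ {z | z ∈ M.E ∧ (z = e ∨ z ∉ M.closure (M.E \ {e, z}))}) (hzC : z ∈ C) :
    {z | z ∈ M.E ∧ (z = e ∨ z ∉ M.closure (M.E \ {e, z}))} ⊆ C := by
  -- first `e ∈ C`
  have heC : e ∈ C := by
    obtain ⟨hzE, hz⟩ := hz
    rcases hz with rfl | hzcl
    · exact hzC
    by_contra heC
    have hsub : C \ {z} ⊆ M.E \ {e, z} := by
      intro x hx
      refine ⟨hC.subset_ground hx.1, ?_⟩
      simp only [mem_insert_iff, mem_singleton_iff, not_or]
      exact ⟨fun hxe => heC (hxe ▸ hx.1), hx.2⟩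
    exact hzcl (M.closure_subset_closure hsub (hC.mem_closure_sdiff_singleton_of_mem hzC))
  exact isCircuit_seriesClass_subset_of_mem M hK he hC heC

/-- **THE COMPLEMENT OF THE SERIES CLASS IS COLOOP-FREE**: every `g ∉ Z(e)` (`g ∈ E`) lies in `cl ((E ∖ Z(e)) ∖ {g})`. -/
theorem mem_closure_sdiff_seriesClass (M : Matroid α) [M.Finite] (hK : ∀ e, ¬ M.IsColoop e) {e : α}
    (he : e ∈ M.E) {g : α} (hg : g ∈ M.E \ {z | z ∈ M.E ∧ (z = e ∨ z ∉ M.closure (M.E \ {e, z}))}) :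
    g ∈ M.closure ((M.E \ {z | z ∈ M.E ∧ (z = e ∨ z ∉ M.closure (M.E \ {e, z}))}) \ {g}) := by
  obtain ⟨hgE, hgZ⟩ := hg
  simp only [mem_setOf_eq, not_and, not_or, not_not] at hgZ
  obtain ⟨hge, hgcl⟩ := hgZ hgE
  have hgnot : g ∉ M.E \ {e, g} := fun h => h.2 (mem_insert_of_mem e (mem_singleton g))
  rw [Matroid.mem_closure_iff_exists_isCircuit hgnot] at hgcl
  obtain ⟨C, hCsub, hC, hgC⟩ := hgcl
  -- `C` avoids `e`, hence avoids the whole series class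
  have heC : e ∉ C := by
    intro heC
    have := hCsub heC
    rcases this with h | h
    · exact hge h.symm
    · exact h.2 (mem_insert e {g})
  have hCZ : C ⊆ (M.E \ {z | z ∈ M.E ∧ (z = e ∨ z ∉ M.closure (M.E \ {e, z}))}) := by
    intro x hx
    refine ⟨hC.subset_ground hx, fun hxZ => ?_⟩
    exact heC (isCircuit_seriesClass_subset M hK he hC hxZ hx (mem_seriesClass_self M he))
  have hsub : C \ {g} ⊆ (M.E \ {z | z ∈ M.E ∧ (z = e ∨ z ∉ M.closure (M.E \ {e, z}))}) \ {g} :=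
    fun x hx => ⟨hCZ hx.1, hx.2⟩
  exact M.closure_subset_closure hsub (hC.mem_closure_sdiff_singleton_of_mem hgC)

/-- Removing a set `W` of points of `Z(e) ∖ {e}` from `E ∖ {e}` drops the rank by exactly `|W|`
(each such point is a coloop of `M ∖ e`). -/
theorem eRk_toNat_sdiff_insert_add (M : Matroid α) [M.Finite] (e : α) :
    ∀ (W : Set α), W.Finite → W ⊆ {z | z ∈ M.E ∧ (z = e ∨ z ∉ M.closure (M.E \ {e, z}))} \ {e} →
      (M.eRk (M.E \ insert e W)).toNat + W.ncard = (M.eRk (M.E \ {e})).toNat := by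
  intro W hWfin
  refine Set.Finite.induction_on (motive := fun W _ => W ⊆ {z | z ∈ M.E ∧ (z = e ∨ z ∉ M.closure (M.E \ {e, z}))} \ {e} →
      (M.eRk (M.E \ insert e W)).toNat + W.ncard = (M.eRk (M.E \ {e})).toNat) W hWfin ?_ ?_
  · intro _
    simp
  · intro w W hwW hWfin' ih hsub
    have hw := hsub (mem_insert w W)
    have hWsub : W ⊆ {z | z ∈ M.E ∧ (z = e ∨ z ∉ M.closure (M.E \ {e, z}))} \ {e} :=
      (subset_insert w W).trans hsub
    have ih' := ih hWsub
    obtain ⟨⟨hwE, hw'⟩, hwe⟩ := hw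
    have hwe' : w ≠ e := fun h => hwe (h ▸ mem_singleton e)
    have hwcl : w ∉ M.closure (M.E \ {e, w}) := by
      rcases hw' with h | h
      · exact absurd h hwe'
      · exact h
    -- `E ∖ insert e W = insert w (E ∖ insert e (insert w W))`
    have hset : M.E \ insert e W = insert w (M.E \ insert e (insert w W)) := by
      ext x
      simp only [mem_insert_iff, mem_sdiff, not_or]
      constructor
      · rintro ⟨hx, hxe, hxW⟩
        by_cases hxw : x = w
        · exact Or.inl hxw
        · exact Or.inr ⟨hx, hxe, hxw, hxW⟩
      · rintro (rfl | ⟨hx, hxe, _, hxW⟩)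
        · exact ⟨hwE, hwe', hwW⟩
        · exact ⟨hx, hxe, hxW⟩
    have hwnot : w ∉ M.closure (M.E \ insert e (insert w W)) := by
      intro h
      apply hwcl
      refine M.closure_subset_closure ?_ h
      intro x hx
      refine ⟨hx.1, ?_⟩
      simp only [mem_insert_iff, mem_singleton_iff, not_or]
      have := hx.2
      simp only [mem_insert_iff, not_or] at this
      exact ⟨this.1, this.2.1⟩
    have hstep : M.eRk (M.E \ insert e W) = M.eRk (M.E \ insert e (insert w W)) + 1 := by
      rw [hset]
      exact Matroid.eRk_insert_eq_add_one ⟨hwE, hwnot⟩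
    have hfin : M.eRk (M.E \ insert e (insert w W)) ≠ ⊤ :=
      ((M.eRk_le_encard _).trans_lt (M.ground_finite.subset sdiff_subset).encard_lt_top).ne
    have hstep' : (M.eRk (M.E \ insert e W)).toNat = (M.eRk (M.E \ insert e (insert w W))).toNat + 1 := by
      rw [hstep, ENat.toNat_add hfin (by decide : (1 : ℕ∞) ≠ ⊤)]
      rfl
    rw [Set.ncard_insert_of_notMem hwW hWfin']
    omega

/-- **THE RANK OF THE COMPLEMENT OF THE SERIES CLASS**: `rk (E ∖ Z(e)) + |Z(e)| = rk E + 1`. -/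
theorem eRk_toNat_sdiff_seriesClass_add (M : Matroid α) [M.Finite] (hK : ∀ e, ¬ M.IsColoop e) {e : α}
    (he : e ∈ M.E) :
    (M.eRk (M.E \ {z | z ∈ M.E ∧ (z = e ∨ z ∉ M.closure (M.E \ {e, z}))})).toNat +
      {z | z ∈ M.E ∧ (z = e ∨ z ∉ M.closure (M.E \ {e, z}))}.ncard = (M.eRk M.E).toNat + 1 := by
  set Z := {z | z ∈ M.E ∧ (z = e ∨ z ∉ M.closure (M.E \ {e, z}))} with hZ
  have hZE : Z ⊆ M.E := seriesClass_subset_ground M e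
  have hZfin : Z.Finite := M.ground_finite.subset hZE
  have heZ : e ∈ Z := mem_seriesClass_self M he
  have hW := eRk_toNat_sdiff_insert_add M e (Z \ {e}) (hZfin.subset sdiff_subset) (subset_refl _)
  have hins : insert e (Z \ {e}) = Z := by
    rw [insert_sdiff_singleton, insert_eq_of_mem heZ]
  rw [hins] at hW
  have hcard : (Z \ {e}).ncard + 1 = Z.ncard := Set.ncard_sdiff_singleton_add_one heZ hZfin
  rw [eRk_sdiff_singleton_eq_of_not_isColoop M he (hK e)] at hW
  omega

/-- **THE NULLITY OF THE COMPLEMENT OF THE SERIES CLASS** is `ν − 1`: `|E ∖ Z(e)| = rk (E ∖ Z(e)) + (ν − 1)`. -/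
theorem ncard_sdiff_seriesClass_eq (M : Matroid α) [M.Finite] {ν : ℕ} (hd : M.E.encard = M.eRank + (ν : ℕ∞))
    (hK : ∀ e, ¬ M.IsColoop e) {e : α} (he : e ∈ M.E) (hν : 1 ≤ ν) :
    (M.E \ {z | z ∈ M.E ∧ (z = e ∨ z ∉ M.closure (M.E \ {e, z}))}).ncard =
      (M.eRk (M.E \ {z | z ∈ M.E ∧ (z = e ∨ z ∉ M.closure (M.E \ {e, z}))})).toNat + (ν - 1) := by
  have hrk := eRk_toNat_sdiff_seriesClass_add M hK he
  have hnE := ncard_ground_eq_eRk_toNat_add M hd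
  have hcard := Set.ncard_sdiff_add_ncard_of_subset (seriesClass_subset_ground M e) M.ground_finite
  omega

/-- A second point `f ≠ e` of the series class gives `|Z(e)| ≥ 2`. -/
theorem two_le_ncard_seriesClass (M : Matroid α) [M.Finite] {e f : α} (he : e ∈ M.E) (hf : f ∈ M.E)
    (hef : e ≠ f) (h : f ∉ M.closure (M.E \ {e, f})) :
    2 ≤ {z | z ∈ M.E ∧ (z = e ∨ z ∉ M.closure (M.E \ {e, z}))}.ncard := by
  have hsub : ({e, f} : Set α) ⊆ {z | z ∈ M.E ∧ (z = e ∨ z ∉ M.closure (M.E \ {e, z}))} := by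
    intro x hx
    rcases hx with rfl | rfl
    · exact mem_seriesClass_self M he
    · exact ⟨hf, Or.inr h⟩
  have := Set.ncard_le_ncard hsub (M.ground_finite.subset (seriesClass_subset_ground M e))
  rw [ncard_pair hef] at this
  exact this

end S1CFG

end PercRepro
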